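import Summits.HubbardSuperconductivity.HubbardSuperconductivity.Theorems.NodalWardXYDefs
import Literature.Probability.LatticeModels.PlaneRotatorLROProofs
/-!
# `PerturbedXYOrder` (stmt-HubbardSuperconductivity-10739) — line `schwarz-inheritance`, stub `stub_realPlateauEven`

K = 0 plateau of the 3D plane rotator on even tori, uniformly in L (FSS infrared bound; tree theorems).

At `K = 0` the complex plateau `cratio L J 0 = num J 0 / Zk J 0 / L⁶` is the real Gibbs average
`L⁻⁶ ∑_{x,y} ⟨cos(θ_x − θ_y)⟩_{J,L}` of the plane rotator on `(ℤ/Lℤ)³` (`even_re_cratio_zero`), i.e. the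
expectation of `‖m_L‖²` computed by `PlaneRotator.integral_magnetisationNormSq_nVectorGibbs_cosSin`.
Clause (2) of the tree's proved infrared bound `FriedliVelenik2017_nVector_infraredBound_holds`
(Fröhlich–Simon–Spencer 1976; Friedli–Velenik 2017, Thm. 10.24/10.25) gives, for even `L ≥ 4` and `J > 0`,
`Re cratio L J 0 ≥ 1 − torusGreen_L(0)/J`; and `torusGreen_L(0)` is bounded uniformly in even `L`
(`even_torusGreen_zero_le`: the Riemann-sum limit `torusGreen_tendsto_latticeGreen` for large `L`, a finite
sum of absolute values for the finitely many small `L`). Hence `Re cratio L J 0 ≥ 1/2` for `J ≥ max (2M) 1`.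
-/

noncomputable section

namespace Summit.HubbardSuperconductivity.HubbardSuperconductivity.Theorems.PerturbedXYOrder

open MeasureTheory Literature.Probability.LatticeModels
open Summit.HubbardSuperconductivity.HubbardSuperconductivity.Theses.NodalWardXY
open scoped Real

variable {L : ℕ}

/-- At `K = 0` the integrand `w_J e^{W_0}` of `Z_K` is the real XY weight `e^{J ∑_b cos ∇_b θ}`. -/
theorem even_wJ_mul_exp_Wk_zero [NeZero L] (J : ℝ) (θ : TorusSite 3 L → ℝ) :
    wJ J θ * Complex.exp (Wk (0 : Bond L → Bond L → ℂ) θ) =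
      ((Real.exp (J * ∑ b : TorusSite 3 L × Fin 3,
        Real.cos (θ (b.1 + Pi.single b.2 1) - θ b.1)) : ℝ) : ℂ) := by
  have h0 : Wk (0 : Bond L → Bond L → ℂ) θ = 0 := by simp [Wk]
  rw [h0, Complex.exp_zero, mul_one]
  rfl

/-- `Z_0` is the (complexified) real partition function `∫_{[0,2π]^Λ} e^{J ∑_b cos ∇_b θ} dθ`. -/
theorem even_Zk_zero_eq [NeZero L] (J : ℝ) :
    Zk J (0 : Bond L → Bond L → ℂ) =
      ((∫ θ in Set.pi Set.univ fun _ => Set.Icc (0 : ℝ) (2 * π),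
          Real.exp (J * ∑ b : TorusSite 3 L × Fin 3,
            Real.cos (θ (b.1 + Pi.single b.2 1) - θ b.1)) : ℝ) : ℂ) := by
  unfold Zk cube
  simp_rw [even_wJ_mul_exp_Wk_zero]
  rw [integral_complex_ofReal]

/-- The numerator at `K = 0` is the (complexified) real double sum
`∑_{x,y} ∫_{[0,2π]^Λ} cos(θ_x − θ_y) e^{J ∑_b cos ∇_b θ} dθ`. -/
theorem even_num_zero_eq [NeZero L] (J : ℝ) :
    num J (0 : Bond L → Bond L → ℂ) =
      ((∑ x : TorusSite 3 L, ∑ y : TorusSite 3 L,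
          ∫ θ in Set.pi Set.univ fun _ => Set.Icc (0 : ℝ) (2 * π), Real.cos (θ x - θ y) *
            Real.exp (J * ∑ b : TorusSite 3 L × Fin 3,
              Real.cos (θ (b.1 + Pi.single b.2 1) - θ b.1)) : ℝ) : ℂ) := by
  unfold num cube
  simp_rw [even_wJ_mul_exp_Wk_zero, ← Complex.ofReal_mul, integral_complex_ofReal]
  push_cast
  rfl

/-- **`K = 0` reduction**: the real part of the complex plateau at `K = 0` is the Gibbs average
`(Z L⁶)⁻¹ ∑_{x,y} ∫ cos(θ_x − θ_y) e^{J ∑_b cos ∇_b θ} dθ` of the plane rotator (the right-hand side of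
`PlaneRotator.integral_magnetisationNormSq_nVectorGibbs_cosSin`). -/
theorem even_re_cratio_zero [NeZero L] (J : ℝ) :
    (cratio L J (0 : Bond L → Bond L → ℂ)).re =
      (∑ x : TorusSite 3 L, ∑ y : TorusSite 3 L,
          ∫ θ in Set.pi Set.univ fun _ => Set.Icc (0 : ℝ) (2 * π), Real.cos (θ x - θ y) *
            Real.exp (J * ∑ b : TorusSite 3 L × Fin 3,
              Real.cos (θ (b.1 + Pi.single b.2 1) - θ b.1))) /
        ((∫ θ in Set.pi Set.univ fun _ => Set.Icc (0 : ℝ) (2 * π),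
            Real.exp (J * ∑ b : TorusSite 3 L × Fin 3,
              Real.cos (θ (b.1 + Pi.single b.2 1) - θ b.1))) * (L : ℝ) ^ 6) := by
  unfold cratio
  rw [even_num_zero_eq, even_Zk_zero_eq]
  have hL : ((L : ℂ)) ^ 6 = (((L : ℝ) ^ 6 : ℝ) : ℂ) := by push_cast; ring
  rw [hL, ← Complex.ofReal_div, ← Complex.ofReal_div, Complex.ofReal_re, div_div]

/-- **Finite-volume long-range order on even tori** (Fröhlich–Simon–Spencer): for even `L ≥ 4` and
`J > 0`, `Re cratio L J 0 ≥ 1 − torusGreen_L(0)/J` — clause (2) of the tree's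
`FriedliVelenik2017_nVector_infraredBound_holds` (`d = 3`, `ν = 2`, `β = J/2`, single-spin law
`(cos, sin)_* Leb|_{[0,2π]}`) transported to angles by `PlaneRotatorLROProofs`.
[cite: FriedliVelenikSMLS2017, Thm 10.25 with Thm 10.24] -/
theorem even_one_sub_torusGreen_div_le_re_cratio_zero [NeZero L] (hLe : Even L) (hL4 : 4 ≤ L)
    {J : ℝ} (hJ : 0 < J) :
    1 - torusGreen (0 : TorusSite 3 L) / J ≤ (cratio L J (0 : Bond L → Bond L → ℂ)).re := by
  have hfact := (FriedliVelenik2017_nVector_infraredBound_holds 3 L 2 hLe hL4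
    (Measure.map (fun t : ℝ => (![Real.cos t, Real.sin t] : Fin 2 → ℝ))
      (volume.restrict (Set.Icc (0 : ℝ) (2 * π))))
    (PlaneRotator.exists_isCompact_map_angleLaw PlaneRotator.continuous_cosSin)
    (PlaneRotator.map_angleLaw_ne_zero PlaneRotator.continuous_cosSin.measurable) (J / 2)
    (by positivity)).2
    (PlaneRotator.ae_map_angleLaw PlaneRotator.continuous_cosSin PlaneRotator.sum_cosSin_sq)
  rw [PlaneRotator.inv_mul_sum_inv_dispersion_eq_torusGreen,
    PlaneRotator.integral_magnetisationNormSq_nVectorGibbs_cosSin hJ, ← even_re_cratio_zero] at hfact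
  have hcoef : ((2 : ℕ) : ℝ) / (4 * (J / 2)) * torusGreen (0 : TorusSite 3 L) =
      torusGreen (0 : TorusSite 3 L) / J := by
    push_cast
    field_simp
    ring
  rw [hcoef] at hfact
  exact hfact

/-- **`torusGreen_L(0)` is bounded uniformly in even `L`** on `(ℤ/Lℤ)³`: by the Riemann-sum limit
`torusGreen_tendsto_latticeGreen` it is at most `latticeGreen 0 + 1` for even `L ≥ L₀`, and the finitely
many `L < L₀` are absorbed into a finite sum of absolute values. -/
theorem even_torusGreen_zero_le :
    ∃ M : ℝ, ∀ (L : ℕ) [NeZero L], Even L → torusGreen (0 : TorusSite 3 L) ≤ M := by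
  classical
  obtain ⟨L₀, hL₀⟩ :=
    torusGreen_tendsto_latticeGreen (d := 3) le_rfl (0 : Site 3) (ε := 1) one_pos
  set g : ℕ → ℝ := fun n => if h : n = 0 then 0 else @torusGreen 3 n ⟨h⟩ (0 : TorusSite 3 n) with hg
  refine ⟨(Finset.range L₀).sum (fun n => |g n|) + (|latticeGreen (0 : Site 3)| + 1),
    fun L _ hLe => ?_⟩
  have hsum : 0 ≤ (Finset.range L₀).sum (fun n => |g n|) :=
    Finset.sum_nonneg fun n _ => abs_nonneg _
  by_cases hL : L₀ ≤ L
  · have h := hL₀ L hLe hL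
    rw [PlaneRotator.torusProj_zero] at h
    have h2 := (abs_le.1 h).2
    have h3 := le_abs_self (latticeGreen (0 : Site 3))
    linarith
  · rw [not_le] at hL
    have hgL : g L = torusGreen (0 : TorusSite 3 L) := by
      rw [hg]
      dsimp only
      rw [dif_neg (NeZero.ne L)]
    have h1 : |g L| ≤ (Finset.range L₀).sum (fun n => |g n|) :=
      Finset.single_le_sum (f := fun n => |g n|) (fun n _ => abs_nonneg (g n))
        (Finset.mem_range.2 hL)
    have h2 : torusGreen (0 : TorusSite 3 L) ≤ |g L| := hgL ▸ le_abs_self _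
    have h3 : 0 ≤ |latticeGreen (0 : Site 3)| := abs_nonneg _
    linarith

/-- **The `K = 0` plateau on even tori `L ≥ 4`** (Fröhlich–Simon–Spencer 1976 infrared bound, via the tree's
`FriedliVelenik2017_nVector_infraredBound_holds` and the change of variables of `PlaneRotatorLROProofs`), with a bound on
`torusGreen_L(0)` uniform in even `L`. [cite: FriedliVelenikSMLS2017, Thm 10.25 with Thm 10.24] -/
theorem stub_realPlateauEven :
    ∃ J₁ a₀ : ℝ, 0 < a₀ ∧ ∀ J : ℝ, J₁ ≤ J → ∀ (L : ℕ) [NeZero L], Even L → 4 ≤ L → a₀ ≤ (cratio L J 0).re := by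
  obtain ⟨M, hM⟩ := even_torusGreen_zero_le
  refine ⟨max (2 * M) 1, 1 / 2, by norm_num, fun J hJ L _ hLe hL4 => ?_⟩
  have hJ1 : 1 ≤ J := le_trans (le_max_right _ _) hJ
  have hJM : 2 * M ≤ J := le_trans (le_max_left _ _) hJ
  have hJpos : 0 < J := lt_of_lt_of_le one_pos hJ1
  have hplateau := even_one_sub_torusGreen_div_le_re_cratio_zero hLe hL4 hJpos
  have hG : torusGreen (0 : TorusSite 3 L) / J ≤ 1 / 2 := by
    rw [div_le_iff₀ hJpos]
    linarith [hM L hLe]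
  linarith

end Summit.HubbardSuperconductivity.HubbardSuperconductivity.Theorems.PerturbedXYOrder

end
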